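import Summits.QuantumFields.BalabanUV.T4Continuum.Support.NE9RemainderPieceCoupling

/-!
# NE9RemainderPieceAdditive — the (1.23)-functional of the displayed species is ADDITIVE IN THE OLD TERM: the iterated Cauchy
# operation `B13Sect1Arith.cauchyOp` is jointly continuous in its parameters and additive in its integrand UNDER CONTINUITY,
# hence `NE9Lemma1RemainderPiece.remPiece` is additive/subtractive in `H` on the analytic class (the «linearity of Taylor
# remainders and of integrals» left instantiation-side by the owner's part 5; cell `pub-balaban`, T4-DAG §2 node U3 / §6 NE9;
# unit b2b-balaban-t4-ne9-formalise-leaf-08 gen 4 — supplier module for the row OWNER's (C) `PieceAdditiveOn`, gen 24)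

HONEST FRAMING (T4-DAG PAGE 1).  Rung (B)+1 of the FINITE-VOLUME T⁴ programme — NOT infinite volume, NOT a mass gap, NOT the
Clay problem.  NE9 (`T4OutputRate.NE9` ∧ `FadingMemory`) is a cell NEW ESTIMATE, NOT PRINTED, NOT discharged here; spine 0/9;
0/18 skeleton leaves instantiated on Bałaban's objects.  HONEST DEPENDENCY (cell line, verbatim): continuum YM on T⁴ ⇐
BetaPertH ∧ nine spine estimates (0/9 proved); BetaPertH ⇐ (D1) ∧ (D4) ∧ CAP+tail; G-an2-4 gates asym, D1 and NE2/3/4.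
`FlowStep.BetaPertH`, (B), (B^μ) do not occur.  [II] = [Balaban1988RG2Cluster] (CMP **116**) is quoted for TYPES only
(ABSOLUTE RULE: nothing printed in the audited series is asserted).

WHERE THIS SITS.  The owner lineage's part 5 `NE9Lemma1RemainderPiece` (gen 23) types the displayed piece (1.23) p. 7 of
[II] §1 — *"(2πi)⁻¹∮dt_□/t_□² ∏_{Δ⊂Y₀∖□̃⁴} ∫ds(Δ)(2πi)⁻¹∮dσ(Δ)/(σ(Δ)−s(Δ))² · 𝐄(□₀,(tζ̃_□ + t_□ζ_□)𝐇_k(σ(Y₀),B′))"*, *"where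
the t_□-integration is over the circle (1.22), and the σ(Δ)-integrations are over the circles |σ(Δ)| = e^{κ₁}"* — as
`remPiece ρ r l H n A s σ = (2πi)⁻¹∮_{|t|=r} t⁻² • cauchyOp ρ l (dirRem H n (A t · ·)) s σ` and bounds it (`norm_remPiece_le`);
its header records what it leaves out: *ADDITIVITY of the functional in `H` (needed to package it as a `PieceData.piece`)
is linearity of Taylor remainders and of integrals — it needs integrability of the contour integrands (continuity in the
parameters) … NOT asserted here*.  The owner's gen-24 class-relative piece form (`NE9Lemma1PieceClass`, p212277) displays
exactly this as the binder `PieceAdditiveOn Adm` (SUBTRACTIVE form, `piece (H₁ − H₂) = piece H₁ − piece H₂` on the class).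
THIS FILE supplies the generic half, on the tree's objects BY NAME and with nothing re-defined:
* §1 `B13Sect1Arith.cauchyOp` (pv20's Literature def, an ordered iteration of `∫₀¹ds(Δ)` and `(2πi)⁻¹∮_{|σ(Δ)|=ρ}dσ(Δ)/(σ−s)²`
  over a LIST of cubes): **`continuous_cauchyOp`** — if the integrand `h x s σ` is jointly continuous in an external
  parameter `x` and the two parameter vectors, so is `cauchyOp ρ l (h x) s σ` (`ρ > 1`; per cube one application of Mathlib's
  `intervalIntegral.continuous_parametric_intervalIntegral_of_continuous'` to the θ-integral of the circle and one to the
  s(Δ)-integral, the s(Δ)-variable CLAMPED by `Set.projIcc 0 1` so that the kernel `(σ − s)⁻²` — singular only at σ = s,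
  impossible for `|σ| = ρ > 1 ≥ s ≥ 0` — is globally continuous; no Fubini); `cauchyOp_smul`/`cauchyOp_neg` UNCONDITIONAL;
  **`cauchyOp_add`**/`cauchyOp_sub` under joint continuity of the two integrands (integrability from continuity:
  `ContinuousOn.circleIntegrable`, `ContinuousOn.intervalIntegrable`).  Without integrability the operation is NOT additive
  (Bochner convention `∫` non-integrable `= 0`) — the BOUND `B13Sect1Arith.norm_cauchyOp_le` needed no such hypothesis,
  LINEARITY does.  Global continuity in the unlisted coordinates is a harmless convention: the operation reads its
  integrand only on the (1.23) constraint set (`DecouplingResummation110Polydisc.cauchyOp_congr_on`, cell module, cited not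
  imported), so any integrand may first be clamped there.
* §2 `dirRem_sub`/`dirRem_add` — the directional Taylor remainder is additive in the old term ON THE ANALYTIC CLASS
  (leaf-03's `NE9RemainderPieceCoupling.taylorRem_sub` on the slice BY NAME; the hypothesis is load-bearing: the
  divided-slope tails take a derivative at 0) — and **`remPiece_add`**/**`remPiece_sub`**: for `ρ > 1`, `r > 0`, `H₁, H₂`
  analytic on the ball `‖z‖ < R`, contour directions `A t s σ` inside that ball, and the two remainder families
  `(t, s, σ) ↦ dirRem Hᵢ n (A t s σ)` JOINTLY CONTINUOUS (the «continuity hypothesis on the contour integrands» — displayed,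
  instantiation-side; it follows from analyticity of `Hᵢ` and continuity of `A` once `A ↦ dirRem H n A` is known continuous
  on the ball, not proved here), `remPiece ρ r l (H₁ ± H₂) n A = remPiece ρ r l H₁ n A ± remPiece ρ r l H₂ n A`.
WHAT THIS DOES NOT DO: the `CPieceData` INSTANCE of the displayed species (index sets, the re/im encoding of complex-valued
old terms, `PieceZero`/`PieceLocal`/`PieceBoundOnG` — the owner's part 2), the domain inclusions (I.3.36)–(3.53) (TYPE),
anything of leaf A3 (`NE9RemainderPieceCoupling`, `NE9PieceCouplingModulus*`), O1.  DISGUISE TEST: one polymer functional,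
one direction family, sums of two old terms; calculus of the contour operation — no history comparison, not NE9.

References (TYPES only): [Balaban1988RG2Cluster] T. Bałaban, *Renormalization group approach to lattice gauge field
theories. II*, Commun. Math. Phys. **116** (1988) 1–22, (1.22)–(1.25) p. 7 (render `b2b-balaban-ref1/pages/1988-cmp116-rg-
II-cluster/…-p007-x2.png` re-read as image by this seat, 2026-08-20).  Summits-side NEW work (LEAN PLACEMENT RULE); imports
`NE9RemainderPieceCoupling` (hence `NE9Lemma1RemainderPiece`, `B13Sect1Arith`, `B13ExpansionOrder`) BY NAME; modifies nothing;
0 sorry; `[folklore]`.  Value = the additivity binder of the displayed species' piece made kernel modulo one displayed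
continuity statement, NOT summit progress.
-/

noncomputable section

namespace Summit.QuantumFields.BalabanUV.T4Continuum.NE9RemainderPieceAdditive

open scoped BigOperators
open Metric Set Complex MeasureTheory
open Literature.MathematicalPhysics.QuantumFieldTheory.Balaban1983to89
open Literature.MathematicalPhysics.QuantumFieldTheory.Balaban1983to89.B13Sect1Arith (cauchyOp)
open Summit.QuantumFields.BalabanUV.T4Continuum.NE9Lemma1RemainderPiece
open Summit.QuantumFields.BalabanUV.T4Continuum.NE9RemainderPieceCoupling (taylorRem_sub)

/-! ## §1 The iterated Cauchy operation of (1.23): joint continuity in the parameters, additivity under continuity -/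

section CauchyOp

variable {ι : Type*} [DecidableEq ι] {E : Type*} [NormedAddCommGroup E] [NormedSpace ℂ E]

/-- ONE CUBE OF (1.23) WITH THE REAL VARIABLE CLAMPED TO `[0,1]` IS JOINTLY CONTINUOUS: for `ρ > 1` and an inner
function `G y u z` jointly continuous in `(y, u, z)`, the map
`(y, u) ↦ (2πi)⁻¹∮_{|z|=ρ} dz/(z − ū)² · G y ū z` with `ū := projIcc 0 1 u ∈ [0,1]` is continuous — on the circle
`|z| = ρ > 1 ≥ ū` the kernel `(z − ū)⁻²` has no singularity, so the θ-integrand is jointly continuous and Mathlib's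
`intervalIntegral.continuous_parametric_intervalIntegral_of_continuous'` applies.  (The clamp is immaterial for the
operation itself, whose `s(Δ)`-integral runs over `[0,1]`; it only makes the integrand globally continuous in `u`.)
[folklore] -/
theorem continuous_cauchyStep {ρ : ℝ} (hρ : 1 < ρ) {Y : Type*} [TopologicalSpace Y] {G : Y → ℝ → ℂ → E}
    (hG : Continuous fun q : Y × ℝ × ℂ => G q.1 q.2.1 q.2.2) :
    Continuous fun q : Y × ℝ => (2 * Real.pi * I : ℂ)⁻¹ • ∮ z in C(0, ρ),
      ((z - ((Set.projIcc (0:ℝ) 1 zero_le_one q.2 : ℝ) : ℂ)) ^ 2)⁻¹ •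
        G q.1 (Set.projIcc (0:ℝ) 1 zero_le_one q.2) z := by
  have hρ0 : 0 ≤ ρ := zero_le_one.trans hρ.le
  have hπc : Continuous fun u : ℝ => ((Set.projIcc (0:ℝ) 1 zero_le_one u : ℝ) : ℂ) :=
    continuous_ofReal.comp (continuous_subtype_val.comp (continuous_projIcc (a := (0:ℝ)) (b := 1) (h := zero_le_one)))
  have hπm : ∀ u : ℝ, (Set.projIcc (0:ℝ) 1 zero_le_one u : ℝ) ∈ Icc (0:ℝ) 1 := fun u =>
    (Set.projIcc (0:ℝ) 1 zero_le_one u).2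
  have hπr : Continuous fun u : ℝ => (Set.projIcc (0:ℝ) 1 zero_le_one u : ℝ) :=
    continuous_subtype_val.comp (continuous_projIcc (a := (0:ℝ)) (b := 1) (h := zero_le_one))
  -- the pieces of the θ-integrand, as functions of w = ((y, u), θ)
  have hcm : Continuous fun w : (Y × ℝ) × ℝ => circleMap 0 ρ w.2 := (continuous_circleMap 0 ρ).comp continuous_snd
  have hπw : Continuous fun w : (Y × ℝ) × ℝ => ((Set.projIcc (0:ℝ) 1 zero_le_one w.1.2 : ℝ) : ℂ) :=
    hπc.comp (continuous_snd.comp continuous_fst)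
  have hd : Continuous fun w : (Y × ℝ) × ℝ => deriv (circleMap 0 ρ) w.2 := by
    simp_rw [deriv_circleMap]
    exact hcm.mul continuous_const
  have hne : ∀ w : (Y × ℝ) × ℝ,
      (circleMap 0 ρ w.2 - ((Set.projIcc (0:ℝ) 1 zero_le_one w.1.2 : ℝ) : ℂ)) ^ 2 ≠ 0 := by
    intro w
    apply pow_ne_zero
    intro h0
    rw [sub_eq_zero] at h0
    have hz : ‖circleMap 0 ρ w.2‖ = ρ := by
      have := circleMap_mem_sphere (0:ℂ) hρ0 w.2
      simpa using this
    rw [h0, norm_real, Real.norm_eq_abs, abs_of_nonneg (hπm _).1] at hz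
    linarith [(hπm w.1.2).2]
  have hK : Continuous fun w : (Y × ℝ) × ℝ =>
      ((circleMap 0 ρ w.2 - ((Set.projIcc (0:ℝ) 1 zero_le_one w.1.2 : ℝ) : ℂ)) ^ 2)⁻¹ :=
    ((hcm.sub hπw).pow 2).inv₀ hne
  have hGc : Continuous fun w : (Y × ℝ) × ℝ =>
      G w.1.1 (Set.projIcc (0:ℝ) 1 zero_le_one w.1.2) (circleMap 0 ρ w.2) :=
    hG.comp ((continuous_fst.comp continuous_fst).prodMk
      ((hπr.comp (continuous_snd.comp continuous_fst)).prodMk hcm))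
  -- the θ-integrand of the circle integral is jointly continuous in ((y, u), θ)
  have hΨ : Continuous (Function.uncurry fun (q : Y × ℝ) (θ : ℝ) => deriv (circleMap 0 ρ) θ •
      (((circleMap 0 ρ θ - ((Set.projIcc (0:ℝ) 1 zero_le_one q.2 : ℝ) : ℂ)) ^ 2)⁻¹ •
        G q.1 (Set.projIcc (0:ℝ) 1 zero_le_one q.2) (circleMap 0 ρ θ))) :=
    hd.smul (hK.smul hGc)
  have h := intervalIntegral.continuous_parametric_intervalIntegral_of_continuous' (μ := volume) hΨ 0 (2 * Real.pi)
  simp only [circleIntegral]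
  exact h.const_smul _

/-- **THE ITERATED CAUCHY OPERATION PRESERVES JOINT CONTINUITY IN THE PARAMETER VECTORS** (with an external parameter
`x`): if `(x, s, σ) ↦ h x s σ` is jointly continuous, so is `(x, s, σ) ↦ cauchyOp ρ l (h x) s σ` (`ρ > 1`; induction on
the list of cubes, one clamped cube step `continuous_cauchyStep` and one more parametric interval integral per cube; no
Fubini).  Global continuity in the unlisted coordinates is a harmless convention: the operation reads its integrand only
on the (1.23) constraint set (`DecouplingResummation110Polydisc.cauchyOp_congr_on`). [folklore] -/
theorem continuous_cauchyOp {ρ : ℝ} (hρ : 1 < ρ) {X : Type*} [TopologicalSpace X] (l : List ι) :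
    ∀ {h : X → (ι → ℝ) → (ι → ℂ) → E},
      (Continuous fun p : X × (ι → ℝ) × (ι → ℂ) => h p.1 p.2.1 p.2.2) →
      Continuous fun p : X × (ι → ℝ) × (ι → ℂ) => cauchyOp ρ l (h p.1) p.2.1 p.2.2 := by
  induction l with
  | nil => intro h hh; simpa [cauchyOp] using hh
  | cons i l IH =>
    intro h hh
    have IHh := IH hh
    -- the inner operation at the updated vectors, jointly continuous in ((x,s,σ), u, z)
    have hG : Continuous fun q : (X × (ι → ℝ) × (ι → ℂ)) × ℝ × ℂ =>
        cauchyOp ρ l (h q.1.1) (Function.update q.1.2.1 i q.2.1) (Function.update q.1.2.2 i q.2.2) := by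
      have hm : Continuous fun q : (X × (ι → ℝ) × (ι → ℂ)) × ℝ × ℂ =>
          (q.1.1, Function.update q.1.2.1 i q.2.1, Function.update q.1.2.2 i q.2.2) :=
        (continuous_fst.comp continuous_fst).prodMk
          ((((continuous_fst.comp continuous_snd).comp continuous_fst).update i
              (continuous_fst.comp continuous_snd)).prodMk
            (((continuous_snd.comp continuous_snd).comp continuous_fst).update i
              (continuous_snd.comp continuous_snd)))
      exact IHh.comp hm
    have hstep := continuous_cauchyStep hρ (G := fun (y : X × (ι → ℝ) × (ι → ℂ)) (u : ℝ) (z : ℂ) =>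
      cauchyOp ρ l (h y.1) (Function.update y.2.1 i u) (Function.update y.2.2 i z)) hG
    have hint := intervalIntegral.continuous_parametric_intervalIntegral_of_continuous' (μ := volume)
      (f := fun (p : X × (ι → ℝ) × (ι → ℂ)) (u : ℝ) => (2 * Real.pi * I : ℂ)⁻¹ • ∮ z in C(0, ρ),
        ((z - ((Set.projIcc (0:ℝ) 1 zero_le_one u : ℝ) : ℂ)) ^ 2)⁻¹ •
          cauchyOp ρ l (h p.1) (Function.update p.2.1 i (Set.projIcc (0:ℝ) 1 zero_le_one u))
            (Function.update p.2.2 i z)) hstep 0 1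
    refine hint.congr fun p => ?_
    simp only [cauchyOp]
    refine intervalIntegral.integral_congr fun u hu => ?_
    rw [uIcc_of_le zero_le_one] at hu
    simp only [Set.projIcc_of_mem _ hu]

/-- The parameter-free case: `(s, σ) ↦ cauchyOp ρ l h s σ` is jointly continuous if `h` is. [folklore] -/
theorem continuous_cauchyOp' {ρ : ℝ} (hρ : 1 < ρ) (l : List ι) {h : (ι → ℝ) → (ι → ℂ) → E}
    (hh : Continuous fun p : (ι → ℝ) × (ι → ℂ) => h p.1 p.2) :
    Continuous fun p : (ι → ℝ) × (ι → ℂ) => cauchyOp ρ l h p.1 p.2 := by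
  have e : Continuous fun p : (ι → ℝ) × (ι → ℂ) => ((), p) :=
    (continuous_const : Continuous fun _ : (ι → ℝ) × (ι → ℂ) => ()).prodMk continuous_id
  exact (continuous_cauchyOp (X := Unit) hρ l (h := fun _ : Unit => h) (hh.comp continuous_snd)).comp e

/-- **ℂ-HOMOGENEITY OF THE ITERATED CAUCHY OPERATION** — unconditional (Bochner integrals commute with scalars with no
integrability hypothesis). [folklore] -/
theorem cauchyOp_smul (ρ : ℝ) (c : ℂ) (l : List ι) :
    ∀ (h : (ι → ℝ) → (ι → ℂ) → E) (s : ι → ℝ) (σ : ι → ℂ), cauchyOp ρ l (c • h) s σ = c • cauchyOp ρ l h s σ := by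
  induction l with
  | nil => intro h s σ; simp only [cauchyOp, Pi.smul_apply]
  | cons i l IH =>
    intro h s σ
    simp only [cauchyOp, IH h]
    rw [← intervalIntegral.integral_smul]
    congr 1
    funext u
    rw [smul_comm c, ← circleIntegral.integral_smul c]
    congr 1
    congr 1
    funext z
    exact smul_comm _ _ _

/-- Negation: `cauchyOp ρ l (−h) = −cauchyOp ρ l h` — unconditional. [folklore] -/
theorem cauchyOp_neg (ρ : ℝ) (l : List ι) (h : (ι → ℝ) → (ι → ℂ) → E) (s : ι → ℝ) (σ : ι → ℂ) :
    cauchyOp ρ l (-h) s σ = -cauchyOp ρ l h s σ := by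
  rw [← neg_one_smul ℂ h, cauchyOp_smul, neg_one_smul]

/-- **ADDITIVITY OF THE ITERATED CAUCHY OPERATION UNDER JOINT CONTINUITY** (`ρ > 1`): for integrands `h₁, h₂` jointly
continuous in `(s, σ)`, `cauchyOp ρ l (h₁ + h₂) = cauchyOp ρ l h₁ + cauchyOp ρ l h₂` — at each cube the inner operations are
continuous (`continuous_cauchyOp'`), hence circle-integrable on `|σ(Δ)| = ρ` for `s(Δ) ∈ [0,1]` and interval-integrable on
`[0,1]` (clamped step); without integrability the operation is NOT additive (Bochner convention). [folklore] -/
theorem cauchyOp_add {ρ : ℝ} (hρ : 1 < ρ) (l : List ι) :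
    ∀ {h₁ h₂ : (ι → ℝ) → (ι → ℂ) → E},
      (Continuous fun p : (ι → ℝ) × (ι → ℂ) => h₁ p.1 p.2) →
      (Continuous fun p : (ι → ℝ) × (ι → ℂ) => h₂ p.1 p.2) →
      ∀ (s : ι → ℝ) (σ : ι → ℂ), cauchyOp ρ l (h₁ + h₂) s σ = cauchyOp ρ l h₁ s σ + cauchyOp ρ l h₂ s σ := by
  induction l with
  | nil => intro h₁ h₂ _ _ s σ; simp only [cauchyOp, Pi.add_apply]
  | cons i l IH0 =>
    intro h₁ h₂ hh₁ hh₂ s σ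
    have IH := IH0 hh₁ hh₂
    have hρ0 : 0 ≤ ρ := zero_le_one.trans hρ.le
    -- the kernel (z − u)⁻² is continuous on the circle |z| = ρ for u ∈ [0,1]
    have hK : ∀ u ∈ Icc (0:ℝ) 1, ContinuousOn (fun z : ℂ => ((z - (u:ℂ)) ^ 2)⁻¹) (sphere (0:ℂ) ρ) := by
      intro u hu
      refine ContinuousOn.inv₀ (by fun_prop) fun z hz => pow_ne_zero _ ?_
      intro h0
      have hzn : ‖z‖ = ρ := by simpa using hz
      rw [sub_eq_zero] at h0
      rw [h0, norm_real, Real.norm_eq_abs, abs_of_nonneg hu.1] at hzn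
      linarith [hu.2]
    -- circle integrability of the inner operations at u ∈ [0,1]
    have hci : ∀ {h : (ι → ℝ) → (ι → ℂ) → E}, (Continuous fun p : (ι → ℝ) × (ι → ℂ) => h p.1 p.2) →
        ∀ u ∈ Icc (0:ℝ) 1, CircleIntegrable (fun z => ((z - (u:ℂ)) ^ 2)⁻¹ •
          cauchyOp ρ l h (Function.update s i u) (Function.update σ i z)) 0 ρ := by
      intro h hh u hu
      refine ContinuousOn.circleIntegrable hρ0 ((hK u hu).smul ?_)
      exact ((continuous_cauchyOp' hρ l hh).comp
        ((continuous_const.update i continuous_const).prodMk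
          (continuous_const.update i continuous_id))).continuousOn
    -- interval integrability on [0,1] of the one-cube steps, via the clamped continuous version
    have hii : ∀ {h : (ι → ℝ) → (ι → ℂ) → E}, (Continuous fun p : (ι → ℝ) × (ι → ℂ) => h p.1 p.2) →
        IntervalIntegrable (fun u : ℝ => (2 * Real.pi * I : ℂ)⁻¹ • ∮ z in C(0, ρ), ((z - (u:ℂ)) ^ 2)⁻¹ •
          cauchyOp ρ l h (Function.update s i u) (Function.update σ i z)) volume 0 1 := by
      intro h hh
      have hG : Continuous fun q : Unit × ℝ × ℂ =>
          cauchyOp ρ l h (Function.update s i q.2.1) (Function.update σ i q.2.2) :=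
        (continuous_cauchyOp' hρ l hh).comp
          ((continuous_const.update i (continuous_fst.comp continuous_snd)).prodMk
            (continuous_const.update i (continuous_snd.comp continuous_snd)))
      have hstep := continuous_cauchyStep hρ (G := fun (_ : Unit) (u : ℝ) (z : ℂ) =>
        cauchyOp ρ l h (Function.update s i u) (Function.update σ i z)) hG
      have e : Continuous fun u : ℝ => ((), u) := (continuous_const : Continuous fun _ : ℝ => ()).prodMk continuous_id
      have hcu := hstep.comp e
      refine (hcu.continuousOn.congr ?_).intervalIntegrable
      intro u hu
      rw [uIcc_of_le zero_le_one] at hu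
      simp only [Function.comp_apply, Set.projIcc_of_mem _ hu]
    -- pointwise on [0,1]: split the circle integral
    have hsum : EqOn
        (fun u : ℝ => (2 * Real.pi * I : ℂ)⁻¹ • ∮ z in C(0, ρ), ((z - (u:ℂ)) ^ 2)⁻¹ •
            cauchyOp ρ l (h₁ + h₂) (Function.update s i u) (Function.update σ i z))
        (fun u : ℝ => (2 * Real.pi * I : ℂ)⁻¹ • (∮ z in C(0, ρ), ((z - (u:ℂ)) ^ 2)⁻¹ •
              cauchyOp ρ l h₁ (Function.update s i u) (Function.update σ i z))
            + (2 * Real.pi * I : ℂ)⁻¹ • (∮ z in C(0, ρ), ((z - (u:ℂ)) ^ 2)⁻¹ •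
              cauchyOp ρ l h₂ (Function.update s i u) (Function.update σ i z)))
        (uIcc (0:ℝ) 1) := by
      intro u hu
      rw [uIcc_of_le zero_le_one] at hu
      simp only
      rw [← smul_add, ← circleIntegral.integral_add (hci hh₁ u hu) (hci hh₂ u hu)]
      congr 1
      refine circleIntegral.integral_congr hρ0 fun z _ => ?_
      simp only [IH, smul_add]
    simp only [cauchyOp]
    refine (intervalIntegral.integral_congr hsum).trans ?_
    exact intervalIntegral.integral_add (hii hh₁) (hii hh₂)

/-- Subtraction under joint continuity: `cauchyOp ρ l (h₁ − h₂) = cauchyOp ρ l h₁ − cauchyOp ρ l h₂`. [folklore] -/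
theorem cauchyOp_sub {ρ : ℝ} (hρ : 1 < ρ) (l : List ι) {h₁ h₂ : (ι → ℝ) → (ι → ℂ) → E}
    (hh₁ : Continuous fun p : (ι → ℝ) × (ι → ℂ) => h₁ p.1 p.2)
    (hh₂ : Continuous fun p : (ι → ℝ) × (ι → ℂ) => h₂ p.1 p.2) (s : ι → ℝ) (σ : ι → ℂ) :
    cauchyOp ρ l (h₁ - h₂) s σ = cauchyOp ρ l h₁ s σ - cauchyOp ρ l h₂ s σ := by
  rw [sub_eq_add_neg, cauchyOp_add hρ l hh₁ (by exact hh₂.neg) s σ, cauchyOp_neg, ← sub_eq_add_neg]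

end CauchyOp

/-! ## §2 The (1.23)-functional of the remainder is additive in the old term -/

section Remainder

variable {E : Type*} [NormedAddCommGroup E] [NormedSpace ℂ E] {F : Type*} [NormedAddCommGroup F]
  [NormedSpace ℂ F] [CompleteSpace F]

/-- The directional Taylor remainder is SUBTRACTIVE in the old term on the analytic class: for `H₁, H₂` analytic on the
ball `‖z‖ < R` and a direction inside it, `dirRem (H₁ − H₂) n A = dirRem H₁ n A − dirRem H₂ n A` (leaf-03's
`NE9RemainderPieceCoupling.taylorRem_sub` on the slice; the hypothesis is needed — the divided-slope tails take a
DERIVATIVE at `0`, additive only for differentiable slices). [folklore] -/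
theorem dirRem_sub {H₁ H₂ : E → F} {R : ℝ} (hH₁ : DifferentiableOn ℂ H₁ (ball 0 R))
    (hH₂ : DifferentiableOn ℂ H₂ (ball 0 R)) (n : ℕ) {A : E} (hA : ‖A‖ < R) :
    dirRem (H₁ - H₂) n A = dirRem H₁ n A - dirRem H₂ n A := by
  unfold dirRem
  have hfun : (fun τ : ℂ => (H₁ - H₂) (τ • A)) = (fun τ : ℂ => H₁ (τ • A)) - fun τ : ℂ => H₂ (τ • A) := rfl
  rw [hfun]
  by_cases hA0 : A = 0
  · subst hA0
    have h1 : DifferentiableOn ℂ (fun τ : ℂ => H₁ (τ • (0:E))) (ball 0 1) := by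
      simp only [smul_zero]; exact differentiableOn_const _
    have h2 : DifferentiableOn ℂ (fun τ : ℂ => H₂ (τ • (0:E))) (ball 0 1) := by
      simp only [smul_zero]; exact differentiableOn_const _
    exact taylorRem_sub zero_lt_one h1 h2 n 1
  · have hR : 0 < R / ‖A‖ := div_pos ((norm_nonneg A).trans_lt hA) (norm_pos_iff.mpr hA0)
    exact taylorRem_sub hR (differentiableOn_dirSlice hH₁ hA0) (differentiableOn_dirSlice hH₂ hA0) n 1

/-- The directional Taylor remainder is ADDITIVE in the old term on the analytic class. [folklore] -/
theorem dirRem_add {H₁ H₂ : E → F} {R : ℝ} (hH₁ : DifferentiableOn ℂ H₁ (ball 0 R))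
    (hH₂ : DifferentiableOn ℂ H₂ (ball 0 R)) (n : ℕ) {A : E} (hA : ‖A‖ < R) :
    dirRem (H₁ + H₂) n A = dirRem H₁ n A + dirRem H₂ n A := by
  have h := dirRem_sub (hH₁.add hH₂) hH₂ n hA
  rw [add_sub_cancel_right] at h
  rw [h, sub_add_cancel]

variable {ι : Type*} [DecidableEq ι]

/-- **THE (1.23)-FUNCTIONAL OF THE REMAINDER IS ADDITIVE IN THE OLD TERM** — the «linearity of Taylor remainders and of
integrals» that packaging the displayed species' piece as an additive `PieceData.piece` needs
(`NE9Lemma1RemainderPiece`, header): for `ρ > 1` (print: `ρ = e^{κ₁}`), `r > 0`, old terms `H₁, H₂` analytic on the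
ball `‖z‖ < R`, contour directions `A(t, s, σ)` inside that ball, and the two remainder families
`(t, s, σ) ↦ dirRem Hᵢ n (A t s σ)` JOINTLY CONTINUOUS (the «continuity hypothesis on the contour integrands»,
displayed — instantiation-side), `remPiece ρ r l (H₁ + H₂) n A = remPiece ρ r l H₁ n A + remPiece ρ r l H₂ n A`.
[folklore] -/
theorem remPiece_add {ρ r R : ℝ} (hρ : 1 < ρ) (hr : 0 < r) {H₁ H₂ : E → F}
    (hH₁ : DifferentiableOn ℂ H₁ (ball 0 R)) (hH₂ : DifferentiableOn ℂ H₂ (ball 0 R)) (l : List ι) (n : ℕ)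
    {A : ℂ → (ι → ℝ) → (ι → ℂ) → E} (hAR : ∀ t s σ, ‖A t s σ‖ < R)
    (hC₁ : Continuous fun p : ℂ × (ι → ℝ) × (ι → ℂ) => dirRem H₁ n (A p.1 p.2.1 p.2.2))
    (hC₂ : Continuous fun p : ℂ × (ι → ℝ) × (ι → ℂ) => dirRem H₂ n (A p.1 p.2.1 p.2.2))
    (s : ι → ℝ) (σ : ι → ℂ) :
    remPiece ρ r l (H₁ + H₂) n A s σ = remPiece ρ r l H₁ n A s σ + remPiece ρ r l H₂ n A s σ := by
  unfold remPiece
  have hsplit : ∀ t : ℂ, (fun s' σ' => dirRem (H₁ + H₂) n (A t s' σ')) =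
      (fun s' σ' => dirRem H₁ n (A t s' σ')) + fun s' σ' => dirRem H₂ n (A t s' σ') := by
    intro t; funext s' σ'; simp only [Pi.add_apply]; exact dirRem_add hH₁ hH₂ n (hAR t s' σ')
  have hcont : ∀ {H : E → F}, (Continuous fun p : ℂ × (ι → ℝ) × (ι → ℂ) => dirRem H n (A p.1 p.2.1 p.2.2)) →
      Continuous fun t : ℂ => cauchyOp ρ l (fun s' σ' => dirRem H n (A t s' σ')) s σ := by
    intro H hC
    have e : Continuous fun t : ℂ => (t, (s, σ)) :=
      continuous_id.prodMk (continuous_const : Continuous fun _ : ℂ => (s, σ))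
    exact (continuous_cauchyOp (X := ℂ) hρ l (h := fun t s' σ' => dirRem H n (A t s' σ')) hC).comp e
  have hci : ∀ {H : E → F}, (Continuous fun p : ℂ × (ι → ℝ) × (ι → ℂ) => dirRem H n (A p.1 p.2.1 p.2.2)) →
      CircleIntegrable (fun t => (t ^ 2)⁻¹ • cauchyOp ρ l (fun s' σ' => dirRem H n (A t s' σ')) s σ) 0 r := by
    intro H hC
    refine ContinuousOn.circleIntegrable hr.le (ContinuousOn.smul ?_ (hcont hC).continuousOn)
    refine ContinuousOn.inv₀ (by fun_prop) fun t ht => pow_ne_zero _ ?_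
    intro h0
    have htn : ‖t‖ = r := by simpa using ht
    rw [h0, norm_zero] at htn
    exact hr.ne' htn.symm
  have hpt : ∀ t : ℂ, cauchyOp ρ l (fun s' σ' => dirRem (H₁ + H₂) n (A t s' σ')) s σ =
      cauchyOp ρ l (fun s' σ' => dirRem H₁ n (A t s' σ')) s σ +
        cauchyOp ρ l (fun s' σ' => dirRem H₂ n (A t s' σ')) s σ := by
    intro t
    rw [hsplit t]
    have e : Continuous fun q : (ι → ℝ) × (ι → ℂ) => (t, q) :=
      (continuous_const : Continuous fun _ : (ι → ℝ) × (ι → ℂ) => t).prodMk continuous_id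
    exact cauchyOp_add hρ l (hC₁.comp e) (hC₂.comp e) s σ
  simp_rw [hpt, smul_add]
  rw [circleIntegral.integral_add (hci hC₁) (hci hC₂), smul_add]

/-- **THE (1.23)-FUNCTIONAL OF THE REMAINDER IS SUBTRACTIVE IN THE OLD TERM** (the form `ChannelAdditive` uses:
`T(H₁ − H₂) = T H₁ − T H₂`), same hypotheses as `remPiece_add`. [folklore] -/
theorem remPiece_sub {ρ r R : ℝ} (hρ : 1 < ρ) (hr : 0 < r) {H₁ H₂ : E → F}
    (hH₁ : DifferentiableOn ℂ H₁ (ball 0 R)) (hH₂ : DifferentiableOn ℂ H₂ (ball 0 R)) (l : List ι) (n : ℕ)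
    {A : ℂ → (ι → ℝ) → (ι → ℂ) → E} (hAR : ∀ t s σ, ‖A t s σ‖ < R)
    (hC₁ : Continuous fun p : ℂ × (ι → ℝ) × (ι → ℂ) => dirRem H₁ n (A p.1 p.2.1 p.2.2))
    (hC₂ : Continuous fun p : ℂ × (ι → ℝ) × (ι → ℂ) => dirRem H₂ n (A p.1 p.2.1 p.2.2))
    (s : ι → ℝ) (σ : ι → ℂ) :
    remPiece ρ r l (H₁ - H₂) n A s σ = remPiece ρ r l H₁ n A s σ - remPiece ρ r l H₂ n A s σ := by
  unfold remPiece
  have hsplit : ∀ t : ℂ, (fun s' σ' => dirRem (H₁ - H₂) n (A t s' σ')) =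
      (fun s' σ' => dirRem H₁ n (A t s' σ')) - fun s' σ' => dirRem H₂ n (A t s' σ') := by
    intro t; funext s' σ'; simp only [Pi.sub_apply]; exact dirRem_sub hH₁ hH₂ n (hAR t s' σ')
  have hcont : ∀ {H : E → F}, (Continuous fun p : ℂ × (ι → ℝ) × (ι → ℂ) => dirRem H n (A p.1 p.2.1 p.2.2)) →
      Continuous fun t : ℂ => cauchyOp ρ l (fun s' σ' => dirRem H n (A t s' σ')) s σ := by
    intro H hC
    have e : Continuous fun t : ℂ => (t, (s, σ)) :=
      continuous_id.prodMk (continuous_const : Continuous fun _ : ℂ => (s, σ))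
    exact (continuous_cauchyOp (X := ℂ) hρ l (h := fun t s' σ' => dirRem H n (A t s' σ')) hC).comp e
  have hci : ∀ {H : E → F}, (Continuous fun p : ℂ × (ι → ℝ) × (ι → ℂ) => dirRem H n (A p.1 p.2.1 p.2.2)) →
      CircleIntegrable (fun t => (t ^ 2)⁻¹ • cauchyOp ρ l (fun s' σ' => dirRem H n (A t s' σ')) s σ) 0 r := by
    intro H hC
    refine ContinuousOn.circleIntegrable hr.le (ContinuousOn.smul ?_ (hcont hC).continuousOn)
    refine ContinuousOn.inv₀ (by fun_prop) fun t ht => pow_ne_zero _ ?_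
    intro h0
    have htn : ‖t‖ = r := by simpa using ht
    rw [h0, norm_zero] at htn
    exact hr.ne' htn.symm
  have hpt : ∀ t : ℂ, cauchyOp ρ l (fun s' σ' => dirRem (H₁ - H₂) n (A t s' σ')) s σ =
      cauchyOp ρ l (fun s' σ' => dirRem H₁ n (A t s' σ')) s σ -
        cauchyOp ρ l (fun s' σ' => dirRem H₂ n (A t s' σ')) s σ := by
    intro t
    rw [hsplit t]
    have e : Continuous fun q : (ι → ℝ) × (ι → ℂ) => (t, q) :=
      (continuous_const : Continuous fun _ : (ι → ℝ) × (ι → ℂ) => t).prodMk continuous_id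
    exact cauchyOp_sub hρ l (hC₁.comp e) (hC₂.comp e) s σ
  simp_rw [hpt, smul_sub]
  rw [circleIntegral.integral_sub (hci hC₁) (hci hC₂), smul_sub]

end Remainder

end Summit.QuantumFields.BalabanUV.T4Continuum.NE9RemainderPieceAdditive
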